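import Mathlib

/-!
# Stub `stub_images` — images of one-signed intervals under the two quotient maps
(crux `IsogenyCertificates.BiellipticRealPeriodCell`, stmt-KontsevichZagierPeriods-18685, line `Sketch`)

In the Kontsevich–Zagier calculus on the periods of the bielliptic curve `y² = G(x²)` the line
moves integrals over one-signed intervals `(α, β)` by the maps `φ₁(y) = (y² − s)/m` and
`φ₂(y) = (y⁻² − s)/m` (`m ≠ 0`).  The change-of-variables rule produces the literal images
`φᵢ '' (α, β)`; this file identifies them with intervals:

* for `0 ≤ α ∨ β ≤ 0`: `φ₁ '' (α, β)` is the open interval between `φ₁ α` and `φ₁ β`;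
* for `0 < α ∨ β < 0`: `φ₂ '' (α, β)` is the open interval between `φ₂ α` and `φ₂ β`;
* for `0 < m`, `0 < β`: `φ₂ '' (0, β) = φ₂ '' (−β, 0) = (φ₂ β, ∞)`.

The first two are instances of one elementary fact: a function continuous on `[α, β]` and
strictly monotone or strictly antitone there maps `(α, β)` onto `Set.uIoo (f α) (f β)`
(strict monotonicity gives `⊆`, the intermediate value theorem gives `⊇`).  The third is a direct
double inclusion with the explicit preimage `y = √((m t + s)⁻¹)`, and the `(−β, 0)` version
follows by the symmetry `y ↦ −y`.  No definitions are introduced.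
-/

noncomputable section

open Set

namespace Summit.KontsevichZagierPeriods.IsogenyCertificates.BiellipticRealPeriodCellStubs.Images

/-- A function continuous on `[a, b]` (`a < b`) which is strictly monotone or strictly antitone
there maps the open interval `(a, b)` onto the open interval between `f a` and `f b`. [folklore] -/
theorem image_Ioo_eq_uIoo {f : ℝ → ℝ} {a b : ℝ} (hab : a < b) (hf : ContinuousOn f (Icc a b))
    (hmono : StrictMonoOn f (Icc a b) ∨ StrictAntiOn f (Icc a b)) :
    f '' Ioo a b = uIoo (f a) (f b) := by
  rcases hmono with h | h
  · rw [uIoo_of_lt (h (left_mem_Icc.2 hab.le) (right_mem_Icc.2 hab.le) hab)]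
    exact h.image_Ioo_subset.antisymm (intermediate_value_Ioo hab.le hf)
  · rw [uIoo_of_gt (h (left_mem_Icc.2 hab.le) (right_mem_Icc.2 hab.le) hab)]
    exact h.image_Ioo_subset.antisymm (intermediate_value_Ioo' hab.le hf)

/-- On a one-signed interval `[α, β]` the square map is strictly monotone (`0 ≤ α`) or strictly
antitone (`β ≤ 0`). [folklore] -/
theorem sq_strictMonoOn_or {α β : ℝ} (h : 0 ≤ α ∨ β ≤ 0) :
    StrictMonoOn (fun y : ℝ => y ^ 2) (Icc α β) ∨ StrictAntiOn (fun y : ℝ => y ^ 2) (Icc α β) := by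
  rcases h with h | h
  · refine Or.inl fun x hx y hy hxy => ?_
    dsimp only
    nlinarith [mul_pos (sub_pos.2 hxy) (by linarith [hx.1, hy.1] : 0 < x + y)]
  · refine Or.inr fun x hx y hy hxy => ?_
    dsimp only
    nlinarith [mul_pos_of_neg_of_neg (sub_neg.2 hxy) (by linarith [hx.2, hy.2] : x + y < 0)]

/-- Post-composition with the affine bijection `t ↦ (t − s)/m` (`m ≠ 0`) preserves
"strictly monotone or strictly antitone". [folklore] -/
theorem affine_strictMonoOn_or {g : ℝ → ℝ} {S : Set ℝ} {m : ℝ} (s : ℝ) (hm : m ≠ 0)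
    (hg : StrictMonoOn g S ∨ StrictAntiOn g S) :
    StrictMonoOn (fun y => (g y - s) / m) S ∨ StrictAntiOn (fun y => (g y - s) / m) S := by
  rcases lt_or_gt_of_ne hm with hm | hm
  · rcases hg with hg | hg
    · exact Or.inr fun x hx y hy hxy =>
        (div_lt_div_right_of_neg hm).2 (sub_lt_sub_right (hg hx hy hxy) s)
    · exact Or.inl fun x hx y hy hxy =>
        (div_lt_div_right_of_neg hm).2 (sub_lt_sub_right (hg hx hy hxy) s)
  · rcases hg with hg | hg
    · exact Or.inl fun x hx y hy hxy =>
        div_lt_div_of_pos_right (sub_lt_sub_right (hg hx hy hxy) s) hm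
    · exact Or.inr fun x hx y hy hxy =>
        div_lt_div_of_pos_right (sub_lt_sub_right (hg hx hy hxy) s) hm

/-- Post-composition with inversion reverses "strictly monotone or strictly antitone" for a
positive function. [folklore] -/
theorem inv_strictMonoOn_or {g : ℝ → ℝ} {S : Set ℝ} (hpos : ∀ x ∈ S, 0 < g x)
    (hg : StrictMonoOn g S ∨ StrictAntiOn g S) :
    StrictMonoOn (fun y => (g y)⁻¹) S ∨ StrictAntiOn (fun y => (g y)⁻¹) S := by
  rcases hg with hg | hg
  · exact Or.inr fun x hx y hy hxy => inv_strictAnti₀ (hpos x hx) (hg hx hy hxy)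
  · exact Or.inl fun x hx y hy hxy => inv_strictAnti₀ (hpos y hy) (hg hx hy hxy)

/-- Clause (i): for `m ≠ 0` and a one-signed interval `(α, β)`, the image of `(α, β)` under
`y ↦ (y² − s)/m` is the open interval between the images of the end points. [folklore] -/
theorem image_sqAffine (m s α β : ℝ) (hm : m ≠ 0) (hαβ : α < β) (h : 0 ≤ α ∨ β ≤ 0) :
    (fun y : ℝ => (y ^ 2 - s) / m) '' Ioo α β = uIoo ((α ^ 2 - s) / m) ((β ^ 2 - s) / m) :=
  image_Ioo_eq_uIoo (f := fun y : ℝ => (y ^ 2 - s) / m) hαβ (by fun_prop)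
    (affine_strictMonoOn_or s hm (sq_strictMonoOn_or h))

/-- Clause (ii): for `m ≠ 0` and an interval `(α, β)` bounded away from `0` on one side, the image
of `(α, β)` under `y ↦ (y⁻² − s)/m` is the open interval between the images of the end points.
[folklore] -/
theorem image_invSqAffine (m s α β : ℝ) (hm : m ≠ 0) (hαβ : α < β) (h : 0 < α ∨ β < 0) :
    (fun y : ℝ => ((y ^ 2)⁻¹ - s) / m) '' Ioo α β =
      uIoo (((α ^ 2)⁻¹ - s) / m) (((β ^ 2)⁻¹ - s) / m) := by
  have hpos : ∀ y ∈ Icc α β, 0 < y ^ 2 := by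
    intro y hy
    rcases h with h | h
    · exact pow_pos (h.trans_le hy.1) 2
    · have hy0 : 0 < -y := by linarith [hy.2]
      simpa only [neg_sq] using pow_pos hy0 2
  have hcont : ContinuousOn (fun y : ℝ => ((y ^ 2)⁻¹ - s) / m) (Icc α β) :=
    (((continuousOn_id.pow 2).inv₀ fun y hy => (hpos y hy).ne').sub continuousOn_const).div_const m
  exact image_Ioo_eq_uIoo hαβ hcont (affine_strictMonoOn_or s hm
    (inv_strictMonoOn_or hpos (sq_strictMonoOn_or (h.imp le_of_lt le_of_lt))))

/-- Clause (iii), positive half: for `0 < m` and `0 < β`, the image of `(0, β)` under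
`y ↦ (y⁻² − s)/m` is the ray `((β⁻² − s)/m, ∞)`. [folklore] -/
theorem image_invSqAffine_Ioo_zero (m s β : ℝ) (hm : 0 < m) (hβ : 0 < β) :
    (fun y : ℝ => ((y ^ 2)⁻¹ - s) / m) '' Ioo 0 β = Ioi (((β ^ 2)⁻¹ - s) / m) := by
  ext t
  simp only [mem_image, mem_Ioo, mem_Ioi]
  constructor
  · rintro ⟨y, ⟨hy0, hyβ⟩, rfl⟩
    have h1 : (β ^ 2)⁻¹ < (y ^ 2)⁻¹ :=
      inv_strictAnti₀ (pow_pos hy0 2) (by nlinarith [mul_pos hy0 (sub_pos.2 hyβ)])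
    exact div_lt_div_of_pos_right (sub_lt_sub_right h1 s) hm
  · intro ht
    have hu : (β ^ 2)⁻¹ < m * t + s := by
      have := (div_lt_iff₀ hm).1 ht
      linarith
    have hu0 : 0 < m * t + s := (inv_pos.2 (pow_pos hβ 2)).trans hu
    refine ⟨Real.sqrt ((m * t + s)⁻¹), ⟨Real.sqrt_pos.2 (inv_pos.2 hu0), ?_⟩, ?_⟩
    · rw [Real.sqrt_lt' hβ]
      exact (inv_lt_comm₀ hu0 (pow_pos hβ 2)).2 hu
    · rw [Real.sq_sqrt (inv_pos.2 hu0).le, inv_inv]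
      field_simp
      ring

/-- Clause (iii), negative half: for `0 < m` and `0 < β`, the image of `(−β, 0)` under
`y ↦ (y⁻² − s)/m` is the ray `((β⁻² − s)/m, ∞)` (symmetry `y ↦ −y`). [folklore] -/
theorem image_invSqAffine_Ioo_neg_zero (m s β : ℝ) (hm : 0 < m) (hβ : 0 < β) :
    (fun y : ℝ => ((y ^ 2)⁻¹ - s) / m) '' Ioo (-β) 0 = Ioi (((β ^ 2)⁻¹ - s) / m) := by
  have hneg : Ioo (-β) 0 = Neg.neg '' Ioo 0 β := by rw [image_neg_Ioo, neg_zero]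
  rw [hneg, Set.image_image]
  simp only [neg_sq]
  exact image_invSqAffine_Ioo_zero m s β hm hβ

/-- **G — images of one-signed intervals under the two maps.**  For `m ≠ 0`:
(i) on a one-signed interval `(α, β)` (`0 ≤ α ∨ β ≤ 0`) the image of `(α, β)` under
`y ↦ (y² − s)/m` is `Set.uIoo ((α² − s)/m) ((β² − s)/m)`; (ii) on an interval bounded away from
`0` (`0 < α ∨ β < 0`) the image under `y ↦ (y⁻² − s)/m` is `Set.uIoo ((α⁻² − s)/m) ((β⁻² − s)/m)`;
(iii) for `0 < m`, `0 < β` the images of `(0, β)` and of `(−β, 0)` under `y ↦ (y⁻² − s)/m` are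
both the ray `((β⁻² − s)/m, ∞)`. [folklore] -/
theorem stub_images :
    (∀ (m s α β : ℝ), m ≠ 0 → α < β → (0 ≤ α ∨ β ≤ 0) →
      (fun y : ℝ => (y ^ 2 - s) / m) '' Ioo α β = uIoo ((α ^ 2 - s) / m) ((β ^ 2 - s) / m)) ∧
    (∀ (m s α β : ℝ), m ≠ 0 → α < β → (0 < α ∨ β < 0) →
      (fun y : ℝ => ((y ^ 2)⁻¹ - s) / m) '' Ioo α β = uIoo (((α ^ 2)⁻¹ - s) / m) (((β ^ 2)⁻¹ - s) / m)) ∧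
    (∀ (m s β : ℝ), 0 < m → 0 < β →
      (fun y : ℝ => ((y ^ 2)⁻¹ - s) / m) '' Ioo 0 β = Ioi (((β ^ 2)⁻¹ - s) / m) ∧
      (fun y : ℝ => ((y ^ 2)⁻¹ - s) / m) '' Ioo (-β) 0 = Ioi (((β ^ 2)⁻¹ - s) / m)) :=
  ⟨image_sqAffine, image_invSqAffine, fun m s β hm hβ =>
    ⟨image_invSqAffine_Ioo_zero m s β hm hβ, image_invSqAffine_Ioo_neg_zero m s β hm hβ⟩⟩

end Summit.KontsevichZagierPeriods.IsogenyCertificates.BiellipticRealPeriodCellStubs.Images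

end
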